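import Literature.Probability.LatticeModels.ProductMeasureFoldings
import Literature.Probability.LatticeModels.IsoradialPercolation
import Literature.Probability.Percolation.Percolation
import HarnessLib

/-!
# The reverse-Harris row `P3_{1/2}` from its switching (fibre / class-count) form

Support file for crux `stmt-CriticalPhenomena-4575` (`NoHeavyLowerTail`), seat `prim-l12-p1` gen 27
(`--supports stmt-CriticalPhenomena-4575`); memo `run/shared/lean/prim/prim-l12/FROM-prim-l12-p1-g27-FIBRE-P3HALF-DELMONO.md`.
No definitions, no sorries, standard axioms.

Bond percolation `μ = prodBernoulli w` on a finite vertex type, four vertices `s a b c`; `F = (s↔a) ∩ (s↔b)ᶜ`,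
`c ↔ T = ((c↔s)ᶜ ∩ (c↔a)ᶜ ∩ (c↔b)ᶜ)ᶜ`.  The row the lane needs is `P3_{1/2}`: `μ(F) · μ(c↔T) ≤ 2 · μ(F ∩ c↔T)`
(conclusion of `SuperTerminalQuarticFace.p3_half_of_superTerminalQuartic`; with its mirror image it gives `TCB'_{1/2}`, TCB and
TT-CHORD(`E₃`) via `IncStar.oneSided_of_superTerminal` / `IncStar.tcb_of_oneSided`).  `P3_{1/2}` has bidegree `≤ 2` in every edge
variable, i.e. it is a TWO-LAYER statement, and its coefficientwise ("fibre", "switching") form is a counting inequality on every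
folding `(Δ, u)` of the pattern cube (van den Berg–Gandolfi foldings, tree file `ProductMeasureFoldings`):

  `#{y ∈ fibre Δ u | y ∈ F, y^Δ ∈ c↔T} ≤ 2 · #{y ∈ fibre Δ u | y ∈ F ∩ c↔T}`      (FIBRE-P3½)

(equivalently: for every minor of the graph and every red/blue 2-colouring of its edges,
`#{red ∈ F, blue ∈ c↔T} ≤ 2 · #{red ∈ F ∩ c↔T}`).  FIBRE-P3½ is a CONJECTURE (gen-27 census: 0 negative fibres on K₅, K₆, K₇ minus
the terminal pairs, the hub families khub3(4,5), khub4(3), W99, all multigraphs with ≤ 5 vertices and ≤ 8 edges, 7 000 random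
multigraphs with ≤ 9 vertices and ≤ 17 edges).  This file is the kernel form of the implication FIBRE-P3½ ⟹ P3_{1/2}:
* `sum_pair_le_mul_of_classCount_le` — the folding principle with a constant factor `k`: classwise `#L ≤ k · #R` in every folding
  gives `∑∑ W W 𝟙[L] ≤ k · ∑∑ W W 𝟙[R]` for every product weight (`k = 1` is `Folding.sum_pair_le_of_classCount_le`);
* `prodBernoulli_pair_le_mul_of_classCount_le` — transported to `prodBernoulli p`: for events `A, B, C` determined by a finite set
  `F`, classwise `#{y ∈ A, y^Δ ∈ B} ≤ k · #{y ∈ C}` gives `P(A) · P(B) ≤ k · P(C)` for EVERY parameter vector;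
* `p3_half_of_fibreCount` — **FIBRE-P3½ ⟹ P3_{1/2}** on the given finite weighted graph (`k = 2`, `A = F`, `B = c↔T`,
  `C = F ∩ c↔T`, `F =` all pairs).
So a classwise certificate — a `≤ 2`-to-`1` swap map, or a kernel computation of the class counts on an explicit small support —
is, through `p3_half_of_fibreCount`, the row `P3_{1/2}` for all weights on that support at once.
-/

noncomputable section

namespace Summit.CriticalPhenomena.PercolationContinuityZ3.Theorems.P3HalfOfFibre

open MeasureTheory Set Finset
open Literature.Probability.Percolation Literature.Probability.LatticeModels
open Literature.Probability.LatticeModels.Folding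

/-! ### The folding principle with a constant factor -/

section Folding

variable {α : Type*} [Fintype α] [DecidableEq α]

/-- **Folding principle with a factor.**  If in every folding `(Δ, u)` of the cube `{0,1}^α` the folded pairs `(y, y^Δ)`
satisfying `L` are at most `k` times as many as those satisfying `R`, then
`∑_y ∑_x W(y) W(x) 𝟙[L(y,x)] ≤ k · ∑_y ∑_x W(y) W(x) 𝟙[R(y,x)]` for every product weight `w ≥ 0`
(van den Berg–Gandolfi: a product weight is uniform on every folding, so the pair sum is a positive combination of class counts).
[cite: VandenbergGandolfi2012, proof of Thm. 13 and Lemma 14] -/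
theorem sum_pair_le_mul_of_classCount_le (w : α → Bool → ℝ) (hw : ∀ i b, 0 ≤ w i b)
    (L R : (α → Bool) → (α → Bool) → Prop) [∀ x y, Decidable (L x y)] [∀ x y, Decidable (R x y)]
    (k : ℕ) (h : ∀ (Δ : Finset α) (u : α → Bool), classCount Δ u L ≤ k * classCount Δ u R) :
    ∑ y : α → Bool, ∑ x : α → Bool, wt w y * wt w x * (if L y x then 1 else 0) ≤
      (k : ℝ) * ∑ y : α → Bool, ∑ x : α → Bool, wt w y * wt w x * (if R y x then 1 else 0) := by
  rw [sum_pair_eq_sum_foldings w fun y x => if L y x then (1 : ℝ) else 0,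
    sum_pair_eq_sum_foldings w fun y x => if R y x then (1 : ℝ) else 0, Finset.mul_sum]
  refine Finset.sum_le_sum fun Δ _ => ?_
  rw [Finset.mul_sum]
  refine Finset.sum_le_sum fun u _ => ?_
  rw [sum_fibre_boole_eq_classCount, sum_fibre_boole_eq_classCount]
  have hW : 0 ≤ wt w u * wt w (flipOn Δ u) := mul_nonneg (wt_nonneg hw _) (wt_nonneg hw _)
  have hk : (classCount Δ u L : ℝ) ≤ (k : ℝ) * (classCount Δ u R : ℝ) := by exact_mod_cast h Δ u
  calc wt w u * wt w (flipOn Δ u) * (classCount Δ u L : ℝ)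
      ≤ wt w u * wt w (flipOn Δ u) * ((k : ℝ) * (classCount Δ u R : ℝ)) :=
        mul_le_mul_of_nonneg_left hk hW
    _ = (k : ℝ) * (wt w u * wt w (flipOn Δ u) * (classCount Δ u R : ℝ)) := by ring

end Folding

/-! ### Transport to the product Bernoulli measure -/

section ProdBernoulli

variable {ι : Type*}

/-- **Two-layer rows of `prodBernoulli p` from classwise certificates with a factor.**  Let `A, B, C` be events determined
by a finite set `F`; if on the pattern cube `{0,1}^F`, in every folding `(Δ, u)`, the patterns `y` of the fibre with
`{y} ∈ A, {y^Δ} ∈ B` are at most `k` times as many as those with `{y} ∈ C` (`{y} = cubeCfg F y`), then for EVERY parameter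
`p : ι → [0,1]`, `P(A) · P(B) ≤ k · P(C)`.  (The one-layer event `C` is counted once per pattern of the fibre, i.e. paired
with the sure event in the second layer.) [cite: VandenbergGandolfi2012, proof of Thm. 13 and Lemma 14] -/
theorem prodBernoulli_pair_le_mul_of_classCount_le [DecidableEq ι] (p : ι → unitInterval)
    (F : Finset ι) {A B C : Set (Set ι)}
    [DecidablePred (· ∈ A)] [DecidablePred (· ∈ B)] [DecidablePred (· ∈ C)]
    (hA : DeterminedBy A (↑F : Set ι)) (hB : DeterminedBy B (↑F : Set ι)) (hC : DeterminedBy C (↑F : Set ι))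
    (k : ℕ)
    (h : ∀ (Δ : Finset F) (u : F → Bool),
      ((Folding.fibre Δ u).filter fun y =>
          cubeCfg F y ∈ A ∧ cubeCfg F (Folding.flipOn Δ y) ∈ B).card ≤
        k * ((Folding.fibre Δ u).filter fun y => cubeCfg F y ∈ C).card) :
    (prodBernoulli p).real A * (prodBernoulli p).real B ≤ k * (prodBernoulli p).real C := by
  set w : F → Bool → ℝ := fun i b =>
    if b = true then ((p i : unitInterval) : ℝ) else 1 - ((p i : unitInterval) : ℝ) with hw_def
  have hw : ∀ i b, 0 ≤ w i b := by
    intro i b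
    simp only [hw_def]
    split_ifs
    · exact (p i).2.1
    · exact sub_nonneg.2 (p i).2.2
  -- total mass: `1 = P(univ) = ∑_x W(x)`
  have htot : ∑ x : F → Bool, wt w x = 1 := by
    have hu := prodBernoulli_real_eq_sum_indicator_wt p F (determinedBy_univ (↑F : Set ι))
    rw [probReal_univ, Set.preimage_univ] at hu
    rw [hu]
    refine Finset.sum_congr rfl fun x _ => ?_
    rw [Set.indicator_of_mem (Set.mem_univ _)]
  rw [prodBernoulli_real_eq_sum_indicator_wt p F hA, prodBernoulli_real_eq_sum_indicator_wt p F hB,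
    prodBernoulli_real_eq_sum_indicator_wt p F hC]
  letI : DecidablePred (· ∈ cubeCfg F ⁻¹' A) := fun y => ‹DecidablePred (· ∈ A)› (cubeCfg F y)
  letI : DecidablePred (· ∈ cubeCfg F ⁻¹' B) := fun y => ‹DecidablePred (· ∈ B)› (cubeCfg F y)
  letI : DecidablePred (· ∈ cubeCfg F ⁻¹' C) := fun y => ‹DecidablePred (· ∈ C)› (cubeCfg F y)
  have e1 : (∑ x : F → Bool, (cubeCfg F ⁻¹' A).indicator (wt w) x) *
      ∑ x : F → Bool, (cubeCfg F ⁻¹' B).indicator (wt w) x =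
      ∑ y : F → Bool, ∑ x : F → Bool,
        wt w y * wt w x * (if cubeCfg F y ∈ A ∧ cubeCfg F x ∈ B then 1 else 0) := by
    rw [Finset.sum_mul_sum]
    refine Finset.sum_congr rfl fun y _ => Finset.sum_congr rfl fun x _ => ?_
    by_cases hy : cubeCfg F y ∈ A <;> by_cases hx : cubeCfg F x ∈ B <;>
      simp [Set.indicator, Set.mem_preimage, hy, hx]
  have e2 : (∑ x : F → Bool, (cubeCfg F ⁻¹' C).indicator (wt w) x) =
      ∑ y : F → Bool, ∑ x : F → Bool,
        wt w y * wt w x * (if cubeCfg F y ∈ C then 1 else 0) := by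
    have : (∑ x : F → Bool, (cubeCfg F ⁻¹' C).indicator (wt w) x) =
        (∑ x : F → Bool, (cubeCfg F ⁻¹' C).indicator (wt w) x) * ∑ x : F → Bool, wt w x := by
      rw [htot, mul_one]
    rw [this, Finset.sum_mul_sum]
    refine Finset.sum_congr rfl fun y _ => Finset.sum_congr rfl fun x _ => ?_
    by_cases hy : cubeCfg F y ∈ C <;> simp [Set.indicator, Set.mem_preimage, hy]
  rw [e1, e2]
  refine sum_pair_le_mul_of_classCount_le w hw
    (fun y x => cubeCfg F y ∈ A ∧ cubeCfg F x ∈ B) (fun y _ => cubeCfg F y ∈ C) k ?_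
  intro Δ u
  rw [classCount_eq, classCount_eq]
  exact h Δ u

end ProdBernoulli

/-! ### `FIBRE-P3½ ⟹ P3_{1/2}` -/

section Percolation

open scoped Classical

variable {V : Type*} [Fintype V]

/-- **FIBRE-P3½ ⟹ P3_{1/2}.**  Let `μ = prodBernoulli w` on a finite vertex type, `s a b c : V`, `F = (s↔a) ∩ (s↔b)ᶜ`,
`CT = c ↔ {s,a,b} = ((c↔s)ᶜ ∩ (c↔a)ᶜ ∩ (c↔b)ᶜ)ᶜ`.  If the switching form of the reverse-Harris row holds on this support —
in every folding `(Δ, u)` of the pattern cube over ALL pairs, the patterns `y` with `{y} ∈ F` and `{y^Δ} ∈ CT` are at most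
twice as many as the patterns with `{y} ∈ F ∩ CT` — then `μ(F) · μ(CT) ≤ 2 · μ(F ∩ CT)` for every weight vector `w`, i.e.
`P(c ↔ {s,a,b} | s∼a, s≁b) ≥ ½ · P(c ↔ {s,a,b})` (the hypothesis of `IncStar.oneSided_of_superTerminal` with `κ = ½`).
The case `a = s` is the 3-point row `2μ(s≁b, c↔{s,b}) ≥ μ(s≁b)μ(c↔{s,b})`. [this work] -/
theorem p3_half_of_fibreCount (w : Sym2 V → unitInterval) (s a b c : V)
    (h : ∀ (Δ : Finset (↥(Finset.univ : Finset (Sym2 V)))) (u : (↥(Finset.univ : Finset (Sym2 V))) → Bool),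
      ((Folding.fibre Δ u).filter fun y =>
          cubeCfg Finset.univ y ∈ (openConn s a ∩ (openConn s b)ᶜ : Set (BondConfig V)) ∧
            cubeCfg Finset.univ (Folding.flipOn Δ y) ∈
              (((openConn c s)ᶜ ∩ (openConn c a)ᶜ ∩ (openConn c b)ᶜ)ᶜ : Set (BondConfig V))).card ≤
        2 * ((Folding.fibre Δ u).filter fun y =>
          cubeCfg Finset.univ y ∈
            (openConn s a ∩ (openConn s b)ᶜ ∩ ((openConn c s)ᶜ ∩ (openConn c a)ᶜ ∩ (openConn c b)ᶜ)ᶜ :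
              Set (BondConfig V))).card) :
    (prodBernoulli w).real (openConn s a ∩ (openConn s b)ᶜ : Set (BondConfig V)) *
        (prodBernoulli w).real ((openConn c s)ᶜ ∩ (openConn c a)ᶜ ∩ (openConn c b)ᶜ : Set (BondConfig V))ᶜ ≤
      2 * (prodBernoulli w).real
        (openConn s a ∩ (openConn s b)ᶜ ∩ ((openConn c s)ᶜ ∩ (openConn c a)ᶜ ∩ (openConn c b)ᶜ)ᶜ : Set (BondConfig V)) := by
  -- every event is determined by the full (finite) index set (cf. `CovKL.determinedBy_coe_univ`)
  have hdet : ∀ X : Set (Set (Sym2 V)), DeterminedBy X (↑(Finset.univ : Finset (Sym2 V)) : Set (Sym2 V)) := by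
    intro X
    rw [determinedBy_iff]
    intro ω ω' hω
    rw [Finset.coe_univ, Set.inter_univ, Set.inter_univ] at hω
    rw [hω]
  have key := prodBernoulli_pair_le_mul_of_classCount_le (ι := Sym2 V) w Finset.univ
    (A := (openConn s a ∩ (openConn s b)ᶜ : Set (BondConfig V)))
    (B := (((openConn c s)ᶜ ∩ (openConn c a)ᶜ ∩ (openConn c b)ᶜ)ᶜ : Set (BondConfig V)))
    (C := (openConn s a ∩ (openConn s b)ᶜ ∩ ((openConn c s)ᶜ ∩ (openConn c a)ᶜ ∩ (openConn c b)ᶜ)ᶜ :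
      Set (BondConfig V)))
    (hdet _) (hdet _) (hdet _) 2
    (by
      intro Δ u
      convert h Δ u using 2)
  exact_mod_cast key

end Percolation

end Summit.CriticalPhenomena.PercolationContinuityZ3.Theorems.P3HalfOfFibre

end
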